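import Literature.Computability.AlgebraicComplexity.AlmanLi2026GeneralTensorBound
import Literature.Computability.AlgebraicComplexity.WorstCaseTensorExponent
import HarnessLib

/-!
# Alman–Li 2026, Cor. 7.3: `σ(d) < (2/3)ω` for every `d ≥ 3`

Topic `Literature/Computability/AlgebraicComplexity` (family `MatrixMultiplication`). Source: J. Alman,
B. Li, *Asymptotic Rank Speedup Theorems, Revisited*, arXiv:2605.21738 (2026), §7.2 (held text
`paper:arxiv-2605.21738`, p0019 L60–67): "Let `σ(d)` denote the exponent of `d × d × d` tensors
[KM25], i.e., the smallest `σ` such that every `d × d × d` tensor `T` satisfies `R̃(T) ≤ d^σ`. Then the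
above results imply the following.  **Corollary 7.3.** For any `d > 0`, `σ(d) < (2/3)ω`.  Remark 7.2.
This answers an open problem posed by Kaski [Kaski2025Talk], which asks whether Strassen's bound
`σ(d) ≤ (2/3)ω` can be improved. … our improvement has the form `σ(d) ≤ (2/3)ω − ε_d`, where
`ε_d → 0` rapidly as `d → ∞`."

Proved here for `d ≥ 3` from Thm. 7.1 (`AlmanLi2026.thm71`: the uniform bound
`R̃(T) ≤ B_d = √(d^{4ω/3} + d^{2ω/3} − (d³−d²)^{ω/3})`, and `AlmanLi2026.thm71_lt`: `B_d < d^{2ω/3}`):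
`σ(d) ≤ log_d B_d < 2ω/3`, with `σ(d) = worstCaseTensorExponent K d`
(`WorstCaseTensorExponent.lean`); Strassen's `σ(d) ≤ 2ω/3` (`d ≥ 2`, Remark 7.2) is recorded first as
`AlmanLi2026.worstCaseTensorExponent_le_two_thirds_omega`.
-- TODO(general form): `d = 1, 2` ("for any d > 0"; these are not instances of Thms. 7.1/7.2, which
-- assume `d ≥ 3`, and rest on `σ(1)`, `σ(2) ≤ 1`).
No definitions, no named facts.

## References

* J. Alman, B. Li, *Asymptotic Rank Speedup Theorems, Revisited*, arXiv:2605.21738 (2026), Cor. 7.3,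
  Remark 7.2. [AlmanLi2026]
* P. Kaski, M. Michałek, *A universal sequence of tensors for the asymptotic rank conjecture*, ITCS 2025;
  arXiv:2404.06427, §1.1. [KaskiMichalek2025]
-/

noncomputable section

open scoped BigOperators

namespace Literature.Computability.AlgebraicComplexity

namespace AlmanLi2026

variable (K : Type) [Field K]

/-- **Strassen's bound `σ(d) ≤ (2/3)ω`** (`d ≥ 2`): every `d × d × d` tensor has `R̃(T) ≤ d^{2ω/3}`
(tree `Strassen1988_asymptoticRank_le_rpow_fin`), and `σ(d)` is the least such exponent
("Strassen's bound `σ(d) ≤ (2/3)ω`"; KM: "`σ(𝔽^d ⊗ 𝔽^d ⊗ 𝔽^d) ≤ 2ω/3`").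
[cite: AlmanLi2026, Remark 7.2] [cite: KaskiMichalek2025, §1 (abstract)] -/
theorem worstCaseTensorExponent_le_two_thirds_omega {d : ℕ} (hd : 2 ≤ d) :
    worstCaseTensorExponent K d ≤ 2 * omega K / 3 :=
  worstCaseTensorExponent_le K hd (by linarith [omega_two_le K])
    fun T => Strassen1988_asymptoticRank_le_rpow_fin T

/-- The bound of Thm. 7.1 is at least `1`: `d^{4ω/3} + d^{2ω/3} − (d³−d²)^{ω/3} ≥ d^{2ω/3} ≥ 1`
(`(d³−d²)^{ω/3} ≤ (d³)^{ω/3} = d^ω ≤ d^{4ω/3}`). [cite: AlmanLi2026, Thm. 7.1] -/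
theorem one_le_thm71Bound {d : ℕ} (hd : 3 ≤ d) :
    1 ≤ Real.sqrt ((d : ℝ) ^ (4 * omega K / 3) + (d : ℝ) ^ (2 * omega K / 3)
      - ((d : ℝ) ^ 3 - (d : ℝ) ^ 2) ^ (omega K / 3)) := by
  have hd1 : (1 : ℝ) ≤ d := by exact_mod_cast (show 1 ≤ d by omega)
  have hd0 : (0 : ℝ) ≤ d := by linarith
  have hω : 0 ≤ omega K / 3 := by linarith [omega_two_le K]
  have h32 : (0 : ℝ) ≤ (d : ℝ) ^ 3 - (d : ℝ) ^ 2 := by nlinarith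
  have hA : ((d : ℝ) ^ 3 - (d : ℝ) ^ 2) ^ (omega K / 3) ≤ (d : ℝ) ^ (4 * omega K / 3) :=
    calc ((d : ℝ) ^ 3 - (d : ℝ) ^ 2) ^ (omega K / 3) ≤ ((d : ℝ) ^ 3) ^ (omega K / 3) :=
          Real.rpow_le_rpow h32 (by nlinarith) hω
      _ = (d : ℝ) ^ (3 * (omega K / 3)) := by
          rw [Real.rpow_mul hd0]
          norm_num [Real.rpow_natCast]
      _ ≤ (d : ℝ) ^ (4 * omega K / 3) := Real.rpow_le_rpow_of_exponent_le hd1 (by linarith)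
  have hB : 1 ≤ (d : ℝ) ^ (2 * omega K / 3) := Real.one_le_rpow hd1 (by linarith)
  exact Real.one_le_sqrt.2 (by linarith)

/-- **Alman–Li 2026, Cor. 7.3** (for `d ≥ 3`): `σ(d) < (2/3)ω` — Strassen's bound `σ(d) ≤ (2/3)ω`
on the worst-case exponent of `d × d × d` tensors is strict ("This answers an open problem posed by
Kaski"). From Thm. 7.1: `σ(d) ≤ log_d B_d < 2ω/3`. [cite: AlmanLi2026, Cor. 7.3] -/
theorem cor73 {d : ℕ} (hd : 3 ≤ d) : worstCaseTensorExponent K d < 2 * omega K / 3 := by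
  set B := Real.sqrt ((d : ℝ) ^ (4 * omega K / 3) + (d : ℝ) ^ (2 * omega K / 3)
      - ((d : ℝ) ^ 3 - (d : ℝ) ^ 2) ^ (omega K / 3)) with hBdef
  have hd1 : (1 : ℝ) < d := by exact_mod_cast (show 1 < d by omega)
  have hB1 : 1 ≤ B := one_le_thm71Bound K hd
  have hB0 : 0 < B := by linarith
  have hσ : worstCaseTensorExponent K d ≤ Real.logb d B := by
    refine csSup_le ⟨_, ⟨fun _ _ _ => 0, rfl⟩⟩ ?_
    rintro _ ⟨T, rfl⟩
    show Real.logb d (asymptoticRank T) ≤ Real.logb d B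
    rcases (asymptoticRank_nonneg T).eq_or_lt with h0 | hpos
    · rw [← h0, Real.logb_zero]
      exact Real.logb_nonneg hd1 hB1
    · exact Real.logb_le_logb_of_le hd1 hpos (thm71 K hd T)
  refine hσ.trans_lt ?_
  rw [Real.logb_lt_iff_lt_rpow hd1 hB0]
  exact thm71_lt K hd

/-- Cor. 7.3 in the "smallest exponent" reading: for `d ≥ 3` there is `σ < (2/3)ω` with
`R̃(T) ≤ d^σ` for every `d × d × d` tensor `T` (namely `σ = σ(d)`). [cite: AlmanLi2026, Cor. 7.3] -/
theorem cor73_exists {d : ℕ} (hd : 3 ≤ d) :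
    ∃ σ : ℝ, σ < 2 * omega K / 3 ∧ ∀ T : Fin d → Fin d → Fin d → K, asymptoticRank T ≤ (d : ℝ) ^ σ :=
  ⟨worstCaseTensorExponent K d, cor73 K hd,
    fun T => asymptoticRank_le_rpow_worstCaseTensorExponent K (by omega) T⟩

end AlmanLi2026

end Literature.Computability.AlgebraicComplexity

end
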